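import Summits.QuantumFields.BalabanUV.T4Continuum.Spine.NE9.DirectPairingFamily
import Summits.QuantumFields.BalabanUV.T4Continuum.Spine.NE9.TowerCarriersBox

/-!
# T⁴ programme, spine estimate NE9 (node U3, history side) — KING'S CURRENCY, THE INPUT PROPAGATES: separate uniform continuity in
# EVERY young coupling (the E-side input of `DirectPairing`, census C30) follows from uniform continuity of the renormalization STEP in
# its LAST coupling and in its OLD DATA, per level, by induction through a Markov recursion — CONSTANT-FREE; on a compact parameter
# range the two step clauses are themselves free (joint continuity); on node U2's non-compact t-box their uniformity is load-bearing
# — census item C33 of cell `pub-balaban-gaps`, seat ne9 (gen 7); the continuous-category twin of `AnalyticBranchPropagation` (C29b)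

Cell `pub-balaban-gaps` (YM blitz G2, seat ne9, unit `pub-balaban-gaps-ne9-g7`; record `run/shared/lean/pub/pub-balaban-gaps/ne/NE9.md` §5
row C33).  Summits-side bookkeeping; real analysis on hypothesis SHAPES.  Two toy objects are defined in §5 (`crossStep`, `crossTower` — a
witness); nothing else is defined and nothing of Bałaban's is asserted.

THE MODEL.  A family (index `s : σ` — for the tower of carriers: the run, resp. the section) of MARKOV RECURSIONS driven by the coupling
history: states `V s j g : S` in a pseudo-metric space (the effective action after `j` steps), a coupling-free start (`h0`), and
`V s (j+1) g = Φ s j (g j) (V s j g)` — the `j`-th renormalization step at the LAST coupling `g j` applied to the old data ([Balaban1987RG1]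
p. 256: *"E_k depends also on the effective coupling constants g₀,…,g_{k−1}. It is a sum of contributions coming from the k successive
integrations"*; an older coupling enters ONLY through the old data — the located structure (L1)∕(L4) of the owner lineage's
`T4CouplingAnalyticity`, here with the whole effective action as the Markov state instead of §3's transported family of terms).  Inductive
classes `A j ∋ V s j g` ((1.18) + Thm 3 of [I]: TYPE).  The scale-`m` TERM read by node U3 is a read-out `F s m g = ev s m (V s m g)` (§3).

WHAT IS PROVED.
* §1 `prefix_of_markov`: prefix dependence is automatic (Markov + coupling-free start).
* §2 `propagate` ∕ `sepUC_of_propagation`: [UC-LAST] (per level, the step is uniformly continuous in the last coupling, uniformly over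
  the member `s` and the class-valued old data) + [UC-OLD] (per level, the step is uniformly continuous in the old data on the class,
  uniformly over `s` and the last coupling) ⇒ for every level `m`, coordinate `i`, `ε > 0` ONE `δ > 0` such that admissible histories
  agreeing off `i` and `δ`-close at `i` have `ε`-close states at EVERY level `≤ m` — EXACTLY the separate-uniform-continuity input `hUC`
  of `DirectPairing.bracket_eventually_le` ∕ `DirectPairingFamily.*_family` (uniform over the other coordinates and the family, PER LEVEL).
  Induction on the level: coordinate `i` is varied at level `i + 1` by [UC-LAST] (older levels do not read it, §1) and carried through the
  later steps by [UC-OLD]; NO modulus is composed into a constant, NO Lipschitz constants multiplied, NO renewal, NO contraction, NO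
  clause N2 — the continuous-category twin of `AnalyticBranchPropagation.propagate` (holomorphy ↦ uniform continuity, Cauchy ↦ nothing).
  Cross-level uniformity at fixed AGE — which a composed QUANTITATIVE modulus loses geometrically (that loss IS the renewal route C3 with
  its clause N2) — is not asked: King's currency needs the input per level, `DirectPairing.levelUniform_of_towerRate` restores fixed-age
  uniformity from tower-NE5.
* §3 `sepUC_readOut` and the ENDs BY NAME: `directBracket_eventually_le_of_propagation` (node U3 → U6, via `DirectPairingFamily`'s
  `directBracket_eventually_le_family`) and `uniformSmall_of_propagation` (node U5b, via `uniformSmall_family`) — from tower-NE5 +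
  [UC-LAST] + [UC-OLD] + uniformly continuous read-outs (+ a profile `P_i → 0`); NO hypothesis names a coupling other than the last one.
* §4 `sepUC_hyps_of_compact` ∕ `sepUC_of_compact_markov`: on a COMPACT coupling range with COMPACT classes, JOINT CONTINUITY of each step
  on `I × A j` gives [UC-LAST] and [UC-OLD] for ONE recursion (Heine–Cantor) — print's coupling range IS closed ([Balaban1987RG1] p. 263
  *"C^∞-function of g_{j−1} ∈ [0, γ]"*); what compactness does NOT give is uniformity over an infinite family (the runs ∕ sections at a
  fixed scale — printed KIND of uniformity, [I] Thm 1 p. 259 *"uniformly in the lattice spacing"*, H-reading): there §2's uniform clauses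
  are the honest hypothesis, and across levels at fixed age tower-NE5 pays.
* §5 TWO-SIDEDNESS on node U2's NATIVE, NON-COMPACT t-box `[t₀, ∞[`: the toy `V 1 g = g₀`, `V 2 g = sin(g₁·g₀)` (`crossTower`) is Markov with
  a coupling-free start and steps uniformly continuous in EACH argument for EACH FIXED value of the other (`crossStep_sepUC_last`,
  `crossStep_sepUC_old`), yet C30's input FAILS at level 2, coordinate `g₀` (`crossTower_not_sepUC`: `g₁ = (π∕2 + 2πN)∕t₀`, `g₀ = t₀` against
  `t₀ + π∕g₁`, states `2` apart): the UNIFORMITY inside [UC-LAST]∕[UC-OLD] is load-bearing exactly where compactness is absent.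

VERDICT FOR THE ROW (bookkeeping; nothing of Bałaban's asserted).  In King's currency, GIVEN tower-NE5, the E-side obligation list of
node U3 → U6 (and U5b) reads {[UC-LAST]: each step uniformly continuous in its LAST coupling, uniformly over the inductive class of old
data and over the runs (printed TYPE of the coupling clause: [I] p. 263, C^∞ on the CLOSED interval; the uniformity is H∃ of the printed
KIND, (1.18)∕Thm 1); [UC-OLD]: each step uniformly continuous in the OLD effective action on the class (inspection-level: the old action
enters the fluctuation action linearly through the potentials of [Balaban1988RG2Cluster] Lemma 1 (1.33)–(1.36) p. 9, which the cluster
expansion (2.14) p. 15 exponentiates — an analytic, hence locally uniformly continuous, channel; NOT typed for Bałaban's objects);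
uniformly continuous read-out of a term from the action (a projection)}.  NO statement about an OLDER coupling is owed: the
older-coupling half of NE9 («joint … on the COUPLING HISTORY») is INHERITED qualitatively.  Classification of NE9 UNCHANGED in kind
(WORK-bound on W1: `Φ`, `A`, `V` for Bałaban's step ARE the one-step object; instance 0∕1).  Gain: on print's C^∞ branch (not only the
«(or analytic)» branch of C29∕C29b) the E-side input of King's organisation is ONE qualitative clause per step about the LAST coupling
plus ONE about the old-data channel, both of printed type, no constant anywhere.

HONEST FRAMING: bookkeeping for rung (B)+1 on ONE FIXED finite four-torus; real analysis on hypothesis SHAPES; tower-NE5 is the cell's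
estimate NE5 (NOT PRINTED, NOT PROVED); [UC-LAST]∕[UC-OLD] for Bałaban's step are NOT PRINTED as theorems and NOT PROVED; NE9 NOT PRINTED
∕ NOT PROVED; spine PROVED 0∕9 unchanged; instance 0∕1; NOT UV stability, NOT the continuum limit, NOT infinite volume, NOT a mass gap,
NOT Clay.  HONEST DEPENDENCY: continuum YM on T⁴ ⇐ BetaPertH ∧ nine spine estimates (0∕9 proved); BetaPertH ⇐ (D1) ∧ (D4) ∧ CAP+tail.

References (TYPES only): [Balaban1987RG1] = T. Bałaban, Commun. Math. Phys. **109** (1987) 249–301, p. 256, Thm 1 p. 259, (1.18) p. 263,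
Thm 3 p. 264; [Balaban1988RG2Cluster] = T. Bałaban, Commun. Math. Phys. **116** (1988) 1–22, Lemma 1 (1.33)–(1.36) p. 9, (2.14) p. 15;
[King1986] = C. King, Commun. Math. Phys. **102** (1986) 649–677, §3.2 pp. 656–657.
-/

namespace Summit.QuantumFields.BalabanUV.T4Continuum.NE9.DirectPairingPropagation

open scoped BigOperators
open Finset Filter Topology Metric Set
open Literature.MathematicalPhysics.QuantumFieldTheory.Balaban1983to89.T4CouplingAnalyticity (BoxWindow)
open Summit.QuantumFields.BalabanUV.T4Continuum.NE9.TowerCarriersBox (shift_mem_boxWindow mix_mem_boxWindow)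
open Summit.QuantumFields.BalabanUV.T4Continuum.NE9.DirectPairingFamily
  (directBracket_eventually_le_family uniformSmall_family)

variable {σ : Type*} {S : Type*} [PseudoMetricSpace S] {I : Set ℝ}
  {V : σ → ℕ → (ℕ → ℝ) → S} {Φ : σ → ℕ → ℝ → S → S} {A : ℕ → Set S}

/-! ## §1 Markov recursions with a coupling-free start read only the couplings below the level -/

omit [PseudoMetricSpace S] in
/-- **PREFIX DEPENDENCE IS AUTOMATIC**: a coupling-free start `V s 0` and the Markov recursion `V s (j+1) g = Φ s j (g j) (V s j g)` make
`V s m` read the couplings `< m` only ([Balaban1987RG1] p. 256, in words). [folklore] -/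
theorem prefix_of_markov
    (h0 : ∀ s, ∀ g ∈ BoxWindow I, ∀ g' ∈ BoxWindow I, V s 0 g = V s 0 g')
    (hrec : ∀ s j, ∀ g ∈ BoxWindow I, V s (j + 1) g = Φ s j (g j) (V s j g)) :
    ∀ s m, ∀ g ∈ BoxWindow I, ∀ g' ∈ BoxWindow I, (∀ i, i < m → g i = g' i) → V s m g = V s m g' := by
  intro s m
  induction m with
  | zero => intro g hg g' hg' _; exact h0 s g hg g' hg'
  | succ m ih =>
    intro g hg g' hg' hagree
    rw [hrec s m g hg, hrec s m g' hg', hagree m (Nat.lt_succ_self m),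
      ih g hg g' hg' fun i hi => hagree i (Nat.lt_succ_of_lt hi)]

/-! ## §2 Propagation: [UC-LAST] + [UC-OLD] ⇒ separate uniform continuity in EVERY young coupling, per level, constant-free -/

/-- **THE PROPAGATION LEMMA** (induction on the level; strong form).  Hypotheses (SHAPES, displayed): `h0` coupling-free start; `hrec` the
Markov recursion; `hmem` class membership of the states of admissible histories; `hold` = [UC-OLD]: per level `j` and `ε > 0` ONE `δ > 0` such
that for every member `s` and every last coupling `c ∈ I`, `δ`-close class elements are mapped `ε`-close by `Φ s j c`; `hlast` = [UC-LAST]: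
per level `j` and `ε > 0` ONE `δ > 0` such that for every member and every class element `w`, `δ`-close last couplings in `I` give `ε`-close
values `Φ s j · w`.  Conclusion: for every level `m`, coordinate `i` and `ε > 0` ONE `δ > 0` such that for every member and all admissible
`g, g'` agreeing off `i` with `|g_i − g'_i| ≤ δ`, the states are `ε`-close at EVERY level `l ≤ m`.  Coordinate `i` is varied at level `i + 1`
by [UC-LAST] (levels `≤ i` do not read it, `prefix_of_markov`) and carried through the later steps by [UC-OLD]; no modulus is composed into a
constant, nothing is multiplied. [folklore] -/
theorem propagate
    (h0 : ∀ s, ∀ g ∈ BoxWindow I, ∀ g' ∈ BoxWindow I, V s 0 g = V s 0 g')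
    (hrec : ∀ s j, ∀ g ∈ BoxWindow I, V s (j + 1) g = Φ s j (g j) (V s j g))
    (hmem : ∀ s m, ∀ g ∈ BoxWindow I, V s m g ∈ A m)
    (hold : ∀ j, ∀ ε : ℝ, 0 < ε → ∃ δ : ℝ, 0 < δ ∧ ∀ s, ∀ c ∈ I, ∀ w ∈ A j, ∀ w' ∈ A j,
      dist w w' ≤ δ → dist (Φ s j c w) (Φ s j c w') ≤ ε)
    (hlast : ∀ j, ∀ ε : ℝ, 0 < ε → ∃ δ : ℝ, 0 < δ ∧ ∀ s, ∀ w ∈ A j, ∀ c ∈ I, ∀ c' ∈ I,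
      |c - c'| ≤ δ → dist (Φ s j c w) (Φ s j c' w) ≤ ε) :
    ∀ (m i : ℕ) (ε : ℝ), 0 < ε → ∃ δ : ℝ, 0 < δ ∧ ∀ s, ∀ g ∈ BoxWindow I, ∀ g' ∈ BoxWindow I,
      (∀ k, k ≠ i → g k = g' k) → |g i - g' i| ≤ δ → ∀ l, l ≤ m → dist (V s l g) (V s l g') ≤ ε := by
  have hP := prefix_of_markov h0 hrec
  intro m
  induction m with
  | zero =>
    intro i ε hε
    refine ⟨1, one_pos, fun s g hg g' hg' _ _ l hl => ?_⟩
    rw [Nat.le_zero.mp hl, h0 s g hg g' hg', dist_self]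
    exact hε.le
  | succ m ih =>
    intro i ε hε
    by_cases him : i = m
    · -- the coordinate is the LAST coupling of the step `m → m + 1`; the levels `≤ m` do not read it
      obtain ⟨δ, hδ, hL⟩ := hlast m ε hε
      refine ⟨δ, hδ, fun s g hg g' hg' hagree hdiff l hl => ?_⟩
      have hlow : ∀ l', l' ≤ m → V s l' g = V s l' g' := fun l' hl' =>
        hP s l' g hg g' hg' fun k hk => hagree k (by omega)
      rcases Nat.lt_succ_iff_lt_or_eq.mp (Nat.lt_succ_of_le hl) with hlm | rfl
      · rw [hlow l (Nat.lt_succ_iff.mp hlm), dist_self]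
        exact hε.le
      · rw [hrec s m g hg, hrec s m g' hg', hlow m le_rfl]
        rw [him] at hdiff
        exact hL s _ (hmem s m g' hg') _ (hg m) _ (hg' m) hdiff
    · -- an older coordinate (or one not yet read): carried through the step `m → m + 1` by [UC-OLD]
      obtain ⟨δ₁, hδ₁, hO⟩ := hold m ε hε
      obtain ⟨δ, hδ, hIH⟩ := ih i (min ε δ₁) (lt_min hε hδ₁)
      refine ⟨δ, hδ, fun s g hg g' hg' hagree hdiff l hl => ?_⟩
      rcases Nat.lt_succ_iff_lt_or_eq.mp (Nat.lt_succ_of_le hl) with hlm | rfl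
      · exact (hIH s g hg g' hg' hagree hdiff l (Nat.lt_succ_iff.mp hlm)).trans (min_le_left _ _)
      · rw [hrec s m g hg, hrec s m g' hg', ← hagree m (Ne.symm him)]
        exact hO s _ (hg m) _ (hmem s m g hg) _ (hmem s m g' hg')
          ((hIH s g hg g' hg' hagree hdiff m le_rfl).trans (min_le_right _ _))

/-- **[UC-LAST] + [UC-OLD] ⇒ SEPARATE UNIFORM CONTINUITY OF THE STATES IN EVERY YOUNG COUPLING, PER LEVEL, UNIFORMLY OVER THE OTHER
COUPLINGS AND OVER THE FAMILY** — literally the shape of the `hUC` input of `DirectPairingFamily.bracket_eventually_le_family` for the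
states.  Nothing about an older coupling is assumed. [folklore] -/
theorem sepUC_of_propagation
    (h0 : ∀ s, ∀ g ∈ BoxWindow I, ∀ g' ∈ BoxWindow I, V s 0 g = V s 0 g')
    (hrec : ∀ s j, ∀ g ∈ BoxWindow I, V s (j + 1) g = Φ s j (g j) (V s j g))
    (hmem : ∀ s m, ∀ g ∈ BoxWindow I, V s m g ∈ A m)
    (hold : ∀ j, ∀ ε : ℝ, 0 < ε → ∃ δ : ℝ, 0 < δ ∧ ∀ s, ∀ c ∈ I, ∀ w ∈ A j, ∀ w' ∈ A j,
      dist w w' ≤ δ → dist (Φ s j c w) (Φ s j c w') ≤ ε)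
    (hlast : ∀ j, ∀ ε : ℝ, 0 < ε → ∃ δ : ℝ, 0 < δ ∧ ∀ s, ∀ w ∈ A j, ∀ c ∈ I, ∀ c' ∈ I,
      |c - c'| ≤ δ → dist (Φ s j c w) (Φ s j c' w) ≤ ε) :
    ∀ m i : ℕ, i < m → ∀ ε : ℝ, 0 < ε → ∃ δ : ℝ, 0 < δ ∧ ∀ s, ∀ g ∈ BoxWindow I, ∀ g' ∈ BoxWindow I,
      (∀ k, k ≠ i → g k = g' k) → |g i - g' i| ≤ δ → dist (V s m g) (V s m g') ≤ ε := by
  intro m i _ ε hε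
  obtain ⟨δ, hδ, h⟩ := propagate h0 hrec hmem hold hlast m i ε hε
  exact ⟨δ, hδ, fun s g hg g' hg' ha hd => h s g hg g' hg' ha hd m le_rfl⟩

/-! ## §3 Read-outs, and the ENDs of King's currency BY NAME -/

/-- **UNIFORMLY CONTINUOUS READ-OUTS**: if the scale-`m` term is read from the level-`m` state by a map `ev s m` that is uniformly continuous on
the class `A m`, uniformly over the family (per level), then the terms `F s m g = ev s m (V s m g)` satisfy the separate-uniform-continuity
input `hUC` of `DirectPairingFamily` VERBATIM.  (For a term that is a coordinate of the action the read-out is a projection.) [folklore] -/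
theorem sepUC_readOut {F : σ → ℕ → (ℕ → ℝ) → ℝ} {ev : σ → ℕ → S → ℝ}
    (h0 : ∀ s, ∀ g ∈ BoxWindow I, ∀ g' ∈ BoxWindow I, V s 0 g = V s 0 g')
    (hrec : ∀ s j, ∀ g ∈ BoxWindow I, V s (j + 1) g = Φ s j (g j) (V s j g))
    (hmem : ∀ s m, ∀ g ∈ BoxWindow I, V s m g ∈ A m)
    (hold : ∀ j, ∀ ε : ℝ, 0 < ε → ∃ δ : ℝ, 0 < δ ∧ ∀ s, ∀ c ∈ I, ∀ w ∈ A j, ∀ w' ∈ A j,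
      dist w w' ≤ δ → dist (Φ s j c w) (Φ s j c w') ≤ ε)
    (hlast : ∀ j, ∀ ε : ℝ, 0 < ε → ∃ δ : ℝ, 0 < δ ∧ ∀ s, ∀ w ∈ A j, ∀ c ∈ I, ∀ c' ∈ I,
      |c - c'| ≤ δ → dist (Φ s j c w) (Φ s j c' w) ≤ ε)
    (hev : ∀ m, ∀ ε : ℝ, 0 < ε → ∃ δ : ℝ, 0 < δ ∧ ∀ s, ∀ w ∈ A m, ∀ w' ∈ A m,
      dist w w' ≤ δ → |ev s m w - ev s m w'| ≤ ε)
    (hF : ∀ s m, ∀ g ∈ BoxWindow I, F s m g = ev s m (V s m g)) :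
    ∀ m i : ℕ, i < m → ∀ ε : ℝ, 0 < ε → ∃ δ : ℝ, 0 < δ ∧ ∀ s, ∀ g ∈ BoxWindow I, ∀ g' ∈ BoxWindow I,
      (∀ k, k ≠ i → g k = g' k) → |g i - g' i| ≤ δ → |F s m g - F s m g'| ≤ ε := by
  intro m i hi ε hε
  obtain ⟨δ₁, hδ₁, hE⟩ := hev m ε hε
  obtain ⟨δ, hδ, h⟩ := sepUC_of_propagation h0 hrec hmem hold hlast m i hi δ₁ hδ₁
  refine ⟨δ, hδ, fun s g hg g' hg' ha hd => ?_⟩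
  rw [hF s m g hg, hF s m g' hg']
  exact hE s _ (hmem s m g hg) _ (hmem s m g' hg') (h s g hg g' hg' ha hd)

/-- **KING'S CURRENCY, E-SIDE END FROM THE STEP CLAUSES** (node U3 → U6; `DirectPairingFamily.directBracket_eventually_le_family` BY NAME).
Tower rate for every member's terms (`C₅ ≥ 0`, `0 ≤ θ < 1` — tower-NE5) + the Markov recursion with coupling-free start and classes +
[UC-LAST] + [UC-OLD] + uniformly continuous read-outs + a coordinatewise profile `P_i → 0` ⇒ for every `η > 0` ONE `M₀` with
`|F s (m+n) g − F s m g'| ≤ η` for every member, all `m ≥ M₀`, ALL gaps `n` and all admissible pairs with `|g_{i+n} − g'_i| ≤ P_i` (`i < m`).  NO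
hypothesis names an older coupling; NO constant of the step occurs. [folklore] -/
theorem directBracket_eventually_le_of_propagation {F : σ → ℕ → (ℕ → ℝ) → ℝ} {ev : σ → ℕ → S → ℝ}
    {C₅ θ : ℝ} {P : ℕ → ℝ} (hC : 0 ≤ C₅) (hθ0 : 0 ≤ θ) (hθ1 : θ < 1)
    (hT : ∀ s m, ∀ g ∈ BoxWindow I, |F s (m + 1) g - F s m (fun i => g (i + 1))| ≤ C₅ * θ ^ m)
    (h0 : ∀ s, ∀ g ∈ BoxWindow I, ∀ g' ∈ BoxWindow I, V s 0 g = V s 0 g')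
    (hrec : ∀ s j, ∀ g ∈ BoxWindow I, V s (j + 1) g = Φ s j (g j) (V s j g))
    (hmem : ∀ s m, ∀ g ∈ BoxWindow I, V s m g ∈ A m)
    (hold : ∀ j, ∀ ε : ℝ, 0 < ε → ∃ δ : ℝ, 0 < δ ∧ ∀ s, ∀ c ∈ I, ∀ w ∈ A j, ∀ w' ∈ A j,
      dist w w' ≤ δ → dist (Φ s j c w) (Φ s j c w') ≤ ε)
    (hlast : ∀ j, ∀ ε : ℝ, 0 < ε → ∃ δ : ℝ, 0 < δ ∧ ∀ s, ∀ w ∈ A j, ∀ c ∈ I, ∀ c' ∈ I,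
      |c - c'| ≤ δ → dist (Φ s j c w) (Φ s j c' w) ≤ ε)
    (hev : ∀ m, ∀ ε : ℝ, 0 < ε → ∃ δ : ℝ, 0 < δ ∧ ∀ s, ∀ w ∈ A m, ∀ w' ∈ A m,
      dist w w' ≤ δ → |ev s m w - ev s m w'| ≤ ε)
    (hF : ∀ s m, ∀ g ∈ BoxWindow I, F s m g = ev s m (V s m g))
    (hd : Tendsto P atTop (𝓝 0)) {η : ℝ} (hη : 0 < η) :
    ∃ M₀ : ℕ, ∀ s, ∀ m : ℕ, M₀ ≤ m → ∀ n : ℕ, ∀ g ∈ BoxWindow I, ∀ g' ∈ BoxWindow I,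
      (∀ i, i < m → |g (i + n) - g' i| ≤ P i) → |F s (m + n) g - F s m g'| ≤ η := by
  have hP := prefix_of_markov h0 hrec
  exact directBracket_eventually_le_family hC hθ0 hθ1 (fun g hg => shift_mem_boxWindow hg)
    (fun g hg g' hg' a => mix_mem_boxWindow hg hg' a) hT
    (fun s m g hg g' hg' hagree => by rw [hF s m g hg, hF s m g' hg', hP s m g hg g' hg' hagree])
    (sepUC_readOut h0 hrec hmem hold hlast hev hF) hd hη

/-- **NODE U5b FROM THE STEP CLAUSES** (`DirectPairingFamily.uniformSmall_family` BY NAME): under the same hypotheses (no profile needed), for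
every `η > 0` ONE `δ > 0` such that for every member, EVERY level `m` and all admissible pairs with `|g_i − g'_i| ≤ δ` (`i < m`):
`|F s m g − F s m g'| ≤ η` — the towers are uniformly equicontinuous in the sup-distance of histories, uniformly in the level. [folklore] -/
theorem uniformSmall_of_propagation {F : σ → ℕ → (ℕ → ℝ) → ℝ} {ev : σ → ℕ → S → ℝ}
    {C₅ θ : ℝ} (hC : 0 ≤ C₅) (hθ0 : 0 ≤ θ) (hθ1 : θ < 1)
    (hT : ∀ s m, ∀ g ∈ BoxWindow I, |F s (m + 1) g - F s m (fun i => g (i + 1))| ≤ C₅ * θ ^ m)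
    (h0 : ∀ s, ∀ g ∈ BoxWindow I, ∀ g' ∈ BoxWindow I, V s 0 g = V s 0 g')
    (hrec : ∀ s j, ∀ g ∈ BoxWindow I, V s (j + 1) g = Φ s j (g j) (V s j g))
    (hmem : ∀ s m, ∀ g ∈ BoxWindow I, V s m g ∈ A m)
    (hold : ∀ j, ∀ ε : ℝ, 0 < ε → ∃ δ : ℝ, 0 < δ ∧ ∀ s, ∀ c ∈ I, ∀ w ∈ A j, ∀ w' ∈ A j,
      dist w w' ≤ δ → dist (Φ s j c w) (Φ s j c w') ≤ ε)
    (hlast : ∀ j, ∀ ε : ℝ, 0 < ε → ∃ δ : ℝ, 0 < δ ∧ ∀ s, ∀ w ∈ A j, ∀ c ∈ I, ∀ c' ∈ I,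
      |c - c'| ≤ δ → dist (Φ s j c w) (Φ s j c' w) ≤ ε)
    (hev : ∀ m, ∀ ε : ℝ, 0 < ε → ∃ δ : ℝ, 0 < δ ∧ ∀ s, ∀ w ∈ A m, ∀ w' ∈ A m,
      dist w w' ≤ δ → |ev s m w - ev s m w'| ≤ ε)
    (hF : ∀ s m, ∀ g ∈ BoxWindow I, F s m g = ev s m (V s m g)) {η : ℝ} (hη : 0 < η) :
    ∃ δ : ℝ, 0 < δ ∧ ∀ s, ∀ m : ℕ, ∀ g ∈ BoxWindow I, ∀ g' ∈ BoxWindow I,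
      (∀ i, i < m → |g i - g' i| ≤ δ) → |F s m g - F s m g'| ≤ η := by
  have hP := prefix_of_markov h0 hrec
  exact uniformSmall_family hC hθ0 hθ1 (fun g hg => shift_mem_boxWindow hg)
    (fun g hg g' hg' a => mix_mem_boxWindow hg hg' a) hT
    (fun s m g hg g' hg' hagree => by rw [hF s m g hg, hF s m g' hg', hP s m g hg g' hg' hagree])
    (sepUC_readOut h0 hrec hmem hold hlast hev hF) hη

/-! ## §4 On a compact parameter range the step clauses are free: joint continuity suffices (Heine–Cantor) -/

/-- **COMPACTNESS MAKES [UC-OLD] AND [UC-LAST] FREE** for one step: `I` compact, the class `K` compact, the step `(c, w) ↦ Φ₁ c w` jointly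
continuous on `I × K` ⇒ for every `ε > 0` ONE `δ > 0` serving both clauses (uniform continuity on the compact `I ×ˢ K`,
`IsCompact.uniformContinuousOn_of_continuous`, read in each variable).  Print's coupling range for the last coupling IS a closed interval
([Balaban1987RG1] p. 263 *"g_{j−1} ∈ [0, γ]"*). [folklore] -/
theorem sepUC_hyps_of_compact {Φ₁ : ℝ → S → S} {K : Set S} (hI : IsCompact I) (hK : IsCompact K)
    (hΦ : ContinuousOn (fun p : ℝ × S => Φ₁ p.1 p.2) (I ×ˢ K)) {ε : ℝ} (hε : 0 < ε) :
    ∃ δ : ℝ, 0 < δ ∧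
      (∀ c ∈ I, ∀ w ∈ K, ∀ w' ∈ K, dist w w' ≤ δ → dist (Φ₁ c w) (Φ₁ c w') ≤ ε) ∧
      (∀ w ∈ K, ∀ c ∈ I, ∀ c' ∈ I, |c - c'| ≤ δ → dist (Φ₁ c w) (Φ₁ c' w) ≤ ε) := by
  have huc := (hI.prod hK).uniformContinuousOn_of_continuous hΦ
  obtain ⟨δ, hδ, h⟩ := Metric.uniformContinuousOn_iff_le.1 huc ε hε
  refine ⟨δ, hδ, fun c hc w hw w' hw' hww' => ?_, fun w hw c hc c' hc' hcc' => ?_⟩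
  · have := h (c, w) (mk_mem_prod hc hw) (c, w') (mk_mem_prod hc hw')
      (by rw [Prod.dist_eq, dist_self]; exact max_le hδ.le hww')
    simpa using this
  · have := h (c, w) (mk_mem_prod hc hw) (c', w) (mk_mem_prod hc' hw)
      (by rw [Prod.dist_eq, dist_self, Real.dist_eq]; exact max_le hcc' hδ.le)
    simpa using this

/-- **ONE RECURSION ON A COMPACT RANGE: C30's INPUT FROM JOINT CONTINUITY ALONE.**  A single Markov recursion (`σ = Unit` of §2) with
coupling-free start, compact coupling range `I`, compact classes `A j` and every step jointly continuous on `I × A j` satisfies the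
separate-uniform-continuity input of `DirectPairing.bracket_eventually_le` at every level and coordinate.  What compactness does NOT supply is
uniformity over an infinite family of recursions (the runs ∕ sections of a fixed scale) — there §2's uniform clauses are the hypothesis.
[folklore] -/
theorem sepUC_of_compact_markov {V₁ : ℕ → (ℕ → ℝ) → S} {Φ₁ : ℕ → ℝ → S → S}
    (hI : IsCompact I) (hA : ∀ j, IsCompact (A j))
    (hΦ : ∀ j, ContinuousOn (fun p : ℝ × S => Φ₁ j p.1 p.2) (I ×ˢ A j))
    (h0 : ∀ g ∈ BoxWindow I, ∀ g' ∈ BoxWindow I, V₁ 0 g = V₁ 0 g')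
    (hrec : ∀ j, ∀ g ∈ BoxWindow I, V₁ (j + 1) g = Φ₁ j (g j) (V₁ j g))
    (hmem : ∀ m, ∀ g ∈ BoxWindow I, V₁ m g ∈ A m) :
    ∀ m i : ℕ, i < m → ∀ ε : ℝ, 0 < ε → ∃ δ : ℝ, 0 < δ ∧ ∀ g ∈ BoxWindow I, ∀ g' ∈ BoxWindow I,
      (∀ k, k ≠ i → g k = g' k) → |g i - g' i| ≤ δ → dist (V₁ m g) (V₁ m g') ≤ ε := by
  intro m i hi ε hε
  obtain ⟨δ, hδ, h⟩ := sepUC_of_propagation (σ := Unit) (V := fun _ => V₁) (Φ := fun _ => Φ₁) (A := A)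
    (fun _ => h0) (fun _ => hrec) (fun _ => hmem)
    (fun j ε' hε' => by
      obtain ⟨δ', hδ', h1, _⟩ := sepUC_hyps_of_compact hI (hA j) (hΦ j) hε'
      exact ⟨δ', hδ', fun _ => h1⟩)
    (fun j ε' hε' => by
      obtain ⟨δ', hδ', _, h2⟩ := sepUC_hyps_of_compact hI (hA j) (hΦ j) hε'
      exact ⟨δ', hδ', fun _ => h2⟩)
    m i hi ε hε
  exact ⟨δ, hδ, h ()⟩

/-! ## §5 Two-sidedness on the non-compact t-box: separate (non-uniform) uniform continuity of the steps does NOT propagate -/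

/-- TOY STEPS (a witness object, nothing of Bałaban's): step `0` records the first coupling, step `1` forms `sin (g₁ · old)`, later steps
forget everything. [folklore] -/
noncomputable def crossStep : ℕ → ℝ → ℝ → ℝ
  | 0 => fun c _ => c
  | 1 => fun c w => Real.sin (c * w)
  | _ + 2 => fun _ _ => 0

/-- TOY MARKOV RECURSION driven by `crossStep` from the coupling-free start `0`: `V 1 g = g₀`, `V 2 g = sin(g₁·g₀)`, `V m g = 0` (`m ≥ 3`).
[folklore] -/
noncomputable def crossTower : ℕ → (ℕ → ℝ) → ℝ
  | 0 => fun _ => 0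
  | j + 1 => fun g => crossStep j (g j) (crossTower j g)

/-- Level 2 of the toy is `sin(g₁·g₀)` (the Markov shape `crossTower (j+1) g = crossStep j (g j) (crossTower j g)` and the coupling-free
start hold by `rfl`). [folklore] -/
theorem crossTower_two (g : ℕ → ℝ) : crossTower 2 g = Real.sin (g 1 * g 0) := rfl

/-- Each toy step is uniformly continuous in the LAST coupling for EACH FIXED old datum (step `1`: `|w|`-Lipschitz) — [UC-LAST] WITHOUT the
uniformity over the old data. [folklore] -/
theorem crossStep_sepUC_last (j : ℕ) (w : ℝ) {ε : ℝ} (hε : 0 < ε) :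
    ∃ δ : ℝ, 0 < δ ∧ ∀ c c' : ℝ, |c - c'| ≤ δ → dist (crossStep j c w) (crossStep j c' w) ≤ ε := by
  match j with
  | 0 => exact ⟨ε, hε, fun c c' h => by simpa [crossStep, Real.dist_eq] using h⟩
  | 1 =>
    refine ⟨ε / (|w| + 1), by positivity, fun c c' h => ?_⟩
    simp only [crossStep, Real.dist_eq]
    calc |Real.sin (c * w) - Real.sin (c' * w)| ≤ |c * w - c' * w| := Real.abs_sin_sub_sin_le _ _
      _ = |c - c'| * |w| := by rw [← sub_mul, abs_mul]
      _ ≤ ε / (|w| + 1) * |w| := mul_le_mul_of_nonneg_right h (abs_nonneg w)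
      _ ≤ ε := by
        rw [div_mul_eq_mul_div, div_le_iff₀ (by positivity)]
        nlinarith [abs_nonneg w]
  | k + 2 => exact ⟨1, one_pos, fun c c' _ => by simp [crossStep, hε.le]⟩

/-- Each toy step is uniformly continuous in the OLD datum for EACH FIXED last coupling (step `1`: `|c|`-Lipschitz) — [UC-OLD] WITHOUT the
uniformity over the last coupling. [folklore] -/
theorem crossStep_sepUC_old (j : ℕ) (c : ℝ) {ε : ℝ} (hε : 0 < ε) :
    ∃ δ : ℝ, 0 < δ ∧ ∀ w w' : ℝ, dist w w' ≤ δ → dist (crossStep j c w) (crossStep j c w') ≤ ε := by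
  match j with
  | 0 => exact ⟨1, one_pos, fun w w' _ => by simp [crossStep, hε.le]⟩
  | 1 =>
    refine ⟨ε / (|c| + 1), by positivity, fun w w' h => ?_⟩
    rw [Real.dist_eq] at h
    simp only [crossStep, Real.dist_eq]
    calc |Real.sin (c * w) - Real.sin (c * w')| ≤ |c * w - c * w'| := Real.abs_sin_sub_sin_le _ _
      _ = |c| * |w - w'| := by rw [← mul_sub, abs_mul]
      _ ≤ |c| * (ε / (|c| + 1)) := mul_le_mul_of_nonneg_left h (abs_nonneg c)
      _ ≤ ε := by
        rw [mul_div_assoc', div_le_iff₀ (by positivity)]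
        nlinarith [abs_nonneg c]
  | k + 2 => exact ⟨1, one_pos, fun w w' _ => by simp [crossStep, hε.le]⟩

/-- **THE UNIFORMITY CLAUSES ARE LOAD-BEARING ON THE t-BOX.**  On `BoxWindow [t₀, ∞[` (`t₀ > 0`; node U2's native, NON-COMPACT
currency) the toy — Markov, coupling-free start, every step separately uniformly continuous in each argument (`crossStep_sepUC_last`,
`crossStep_sepUC_old`) — VIOLATES the separate-uniform-continuity input of `DirectPairing.bracket_eventually_le` at level `2`,
coordinate `0`: for every `δ > 0` the admissible pair `g = (t₀, c, c, …)`, `g' = (t₀ + π∕c, c, c, …)`, `c = (π∕2 + 2πN)∕t₀ ≥ max(t₀, π∕δ)`,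
agrees off `0`, is `δ`-close at `0`, and has `|V 2 g − V 2 g'| = |sin(π∕2 + 2πN) − sin(π∕2 + 2πN + π)| = 2`.  So §2's conclusion needs the
uniformity inside [UC-LAST]∕[UC-OLD] exactly where §4's compactness is absent. [folklore] -/
theorem crossTower_not_sepUC {t₀ : ℝ} (ht₀ : 0 < t₀) :
    ¬ (∀ m i : ℕ, i < m → ∀ ε : ℝ, 0 < ε → ∃ δ : ℝ, 0 < δ ∧
        ∀ g ∈ BoxWindow (Ici t₀), ∀ g' ∈ BoxWindow (Ici t₀),
          (∀ k, k ≠ i → g k = g' k) → |g i - g' i| ≤ δ → dist (crossTower m g) (crossTower m g') ≤ 1) := by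
  intro h
  obtain ⟨δ, hδ, hδ'⟩ := h 2 0 (by norm_num) 1 one_pos
  -- a large admissible second coupling `c = (π∕2 + 2πN)∕t₀` with `c ≥ t₀` and `π∕c ≤ δ`
  obtain ⟨N, hN⟩ := exists_nat_ge (t₀ * max t₀ (Real.pi / δ))
  set c : ℝ := (Real.pi / 2 + N * (2 * Real.pi)) / t₀ with hc
  have hπ : 0 < Real.pi := Real.pi_pos
  have hcN : (N : ℝ) / t₀ ≤ c := by
    rw [hc]
    refine div_le_div_of_nonneg_right ?_ ht₀.le
    nlinarith [Real.pi_gt_three, Nat.cast_nonneg (α := ℝ) N]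
  have hcmax : max t₀ (Real.pi / δ) ≤ c := le_trans (by rwa [le_div_iff₀ ht₀, mul_comm]) hcN
  have hct₀ : t₀ ≤ c := (le_max_left _ _).trans hcmax
  have hc0 : 0 < c := ht₀.trans_le hct₀
  have hπc : Real.pi / c ≤ δ := by
    have h1 : Real.pi / δ ≤ c := (le_max_right _ _).trans hcmax
    rw [div_le_iff₀ hδ] at h1
    rw [div_le_iff₀ hc0]; linarith
  -- the pair
  set g : ℕ → ℝ := fun k => if k = 0 then t₀ else c with hg
  set g' : ℕ → ℝ := fun k => if k = 0 then t₀ + Real.pi / c else c with hg'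
  have hgW : g ∈ BoxWindow (Ici t₀) := fun k => by
    by_cases hk : k = 0 <;> simp [hg, hk, hct₀]
  have hg'W : g' ∈ BoxWindow (Ici t₀) := fun k => by
    by_cases hk : k = 0
    · simp only [hg', hk, if_true, Set.mem_Ici]
      exact le_add_of_nonneg_right (div_nonneg hπ.le hc0.le)
    · simp [hg', hk, hct₀]
  have hagree : ∀ k, k ≠ 0 → g k = g' k := fun k hk => by simp [hg, hg', hk]
  have hclose : |g 0 - g' 0| ≤ δ := by
    simp only [hg, hg', if_true]
    rw [show t₀ - (t₀ + Real.pi / c) = -(Real.pi / c) by ring, abs_neg, abs_of_nonneg (div_nonneg hπ.le hc0.le)]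
    exact hπc
  have key := hδ' g hgW g' hg'W hagree hclose
  -- the values: `sin(c·t₀) = 1`, `sin(c·(t₀ + π∕c)) = −1`
  have e1 : c * t₀ = Real.pi / 2 + N * (2 * Real.pi) := by rw [hc, div_mul_cancel₀ _ ht₀.ne']
  have e2 : c * (t₀ + Real.pi / c) = Real.pi / 2 + N * (2 * Real.pi) + Real.pi := by
    rw [mul_add, e1, mul_div_cancel₀ _ hc0.ne']
  have s1 : Real.sin (c * t₀) = 1 := by rw [e1, Real.sin_add_nat_mul_two_pi, Real.sin_pi_div_two]
  have s2 : Real.sin (c * (t₀ + Real.pi / c)) = -1 := by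
    rw [e2, Real.sin_add_pi, Real.sin_add_nat_mul_two_pi, Real.sin_pi_div_two]
  rw [crossTower_two, crossTower_two] at key
  simp only [hg, hg', if_true, one_ne_zero, if_false] at key
  rw [s1, s2, Real.dist_eq] at key; norm_num at key

end Summit.QuantumFields.BalabanUV.T4Continuum.NE9.DirectPairingPropagation
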